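import Literature.NumberTheory.Weil1965.ThetaIntegralOrbitFunctionalUnitary
import Literature.NumberTheory.Weil1965.AdelicFibreMeasures
import HarnessLib

/-!
# The theta-side orbit functional is carried by the rational fibres of its invariant

Topic `NumberTheory/Weil1965`; namespaces `Literature.NumberTheory.Weil1965` (§1, generic) and
`Literature.NumberTheory.Weil1965.UnitaryDoubling` (§2, the dual pair).  KERNEL MATHEMATICS ONLY: proved theorems, no
definition, no named fact, no `sorry`.  Sequel of ★ `ThetaIntegralOrbitFunctional` ∕ ★ `ThetaIntegralOrbitFunctionalUnitary`,
companion of ★ `AdelicFibreMeasures` §2: there the Radon measure `ν_S` of a positive functional `S` on `𝒮_ℝ(𝔸_F^ι)` is the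
sum of its fibre measures `μ_b = ν_S|_{h⁻¹(b)}`, `b ∈ F` (`sum_fibreMeasure`, `integral_schwartzBruhatMeasure_eq_tsum`,
`schwartzBruhatMeasure_eq_smul_of_fibreMeasure_eq` …) under ONE hypothesis `hS0`: «`S Ψ = 0` whenever `tsupport Ψ` lies in
a (compact) set on which `h(x) mod F ≠ 0`».  This file proves `hS0` for the orbit functionals
`Λ(Φ) = ∫_{G/Γ} Σ'_{ξ ≠ 0} Φ(A(g) ξ) dν`:
* §1 (generic) `orbitFunctional_eq_zero_of_forall`, **`orbitFunctionalReal_eq_zero_of_tsupport_subset`**,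
  `orbitFunctionalReal_support` — for ANY `h : 𝔸_F^m → 𝔸_F` invariant under the action (`h (A g x) = h x`) and rational on
  rational points (`h(ξ) ∈ F`): every orbit point `A(g) ξ` has `h(A(g) ξ) = h(ξ) ∈ F`, so a `Ψ` supported where
  `h mod F ≠ 0` vanishes on all of them and `Λ_ℝ(Ψ) = 0` [Weil1965, n° 41 (35): "`μ_b` a pour support `U(b)_A`"];
* §1b (generic) `map_schwartzBruhatMeasure_orbitFunctionalReal_eq`, **`map_fibreMeasure_orbitFunctionalReal_eq`** — the action
  preserves `ν_{Λ_ℝ}` and each fibre measure `ν_{Λ_ℝ}|_{h⁻¹(b)}` (★ `map_schwartzBruhatMeasure_eq` ∕ ★ `map_fibreMeasure_eq` fed with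
  ★ `orbitFunctionalReal_comp`, ★ `twist_mem`) [Weil1965, n° 46];
* §2 (the dual pair `(U(J_V), U(J_𝕎))`, `A = vDiagAct`, `h = hNorm` of ★ `ThetaIntegralOrbitFunctionalUnitary` ED. 2)
`toHermVec_ratPt_eq` ∕ **`toHermVec_ratPt_apply`** (the explicit rational value `z_ξ ∈ E^{N×1}` of `toHermVec ξ`),
  `toHermVec_ratPt_eq_zero_iff`, **`hermForm_toHermVec_ratPt`**, **`hNorm_ratPt_eq`**, `hNorm_ratPt_eq_algebraMap` (the explicit
  rational value `re (h(z_ξ,z_ξ) ⊗ 1)` of `hNorm ξ`) and **`hNorm_ratPt_mem_range`** — RATIONALITY `hNorm(ξ) ∈ F` for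
  `ξ ∈ F^{n+n}` (the Darboux map, the Gram matrix `𝕋 = 𝕋_F ⊗ 1`, the coordinates `𝔸_E = 𝔸_F ⊕ 𝔸_F δ` and the hermitian
  form `J_V ⊗ J_W` are all defined over `F`), and
  **`thetaOrbitFunctionalReal_eq_zero_of_tsupport_subset`**, **`thetaOrbitFunctionalReal_support`** = the `hS0` ∕ `h0₁` input
  of ★ `sum_fibreMeasure` ∕ ★ `linearMap_eq_smul_of_fibreMeasure_eq` for `S := thetaOrbitFunctionalReal ν`, `h := hNorm`, and
  `map_schwartzBruhatMeasure_thetaOrbitFunctionalReal_eq`, **`map_fibreMeasure_thetaOrbitFunctionalReal_eq`** — `U(J_V)(𝔸)`-INVARIANCE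
  of `ν_{Λ_θ}` and of every `μ̂_b := ν_{Λ_θ}|_{hNorm⁻¹(b)}`.

## References
* [Weil1965] A. Weil, *Sur la formule de Siegel dans la théorie des groupes classiques*, Acta Math. 113 (1965): Chap. IV
  n° 41 (35) p. 59, n° 45 p. 66, n° 52.
* [GelbartRogawski1991] S. Gelbart, J. Rogawski, *L-functions and Fourier–Jacobi coefficients for the unitary group U(3)*,
  Invent. Math. 105 (1991), §3.1 p. 454 (the dual pair `U(V) × U(W) → Sp(Res(V ⊗ W))`).
-/

set_option autoImplicit false

noncomputable section

namespace Literature.NumberTheory.Weil1965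

open Literature.NumberTheory.Automorphic Literature.NumberTheory.Weil1964
open NumberField _root_.MeasureTheory Filter _root_.Topology
open scoped Matrix

/-! ### §1 Generic: an invariant, rationally-valued `h` carries the orbit functional -/

section Generic

variable (F : Type) [Field F] [NumberField F] {m : ℕ}
variable {G : Type*} [Group G] [TopologicalSpace G] [IsTopologicalGroup G] [LocallyCompactSpace G]
variable (Γ : Subgroup G) [CompactSpace (G ⧸ Γ)] [MeasurableSpace (G ⧸ Γ)] [BorelSpace (G ⧸ Γ)]
variable (ν : Measure (G ⧸ Γ)) [IsFiniteMeasure ν]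
variable (A : G →* ((Fin m → AdeleRing (𝓞 F) F) ≃ₗ[AdeleRing (𝓞 F) F] (Fin m → AdeleRing (𝓞 F) F)))
variable (hA : ∀ x : Fin m → AdeleRing (𝓞 F) F, Continuous fun g => A g x)
variable (hΓ : ∀ γ ∈ Γ, ∀ ξ : Fin m → F, ∃ ξ' : Fin m → F, A γ (ratPt F (Fin m) ξ) = ratPt F (Fin m) ξ')

omit [TopologicalSpace G] [IsTopologicalGroup G] [LocallyCompactSpace G] in
/-- an orbit sum all of whose terms vanish is `0`. [cite: Weil1965, Chap. IV n° 41, (35) p. 59] -/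
theorem orbitSum_eq_zero_of_forall {Φ : (Fin m → AdeleRing (𝓞 F) F) → ℂ} (g : G)
    (h0 : ∀ ξ : NonzeroRat F m, Φ (A g (ratPt F (Fin m) (ξ : Fin m → F))) = 0) : orbitSum F A Φ g = 0 := by
  unfold orbitSum
  exact (tsum_congr h0).trans tsum_zero

include hA in
/-- **the orbit functional of a `Φ` vanishing on every orbit point `A(g) ξ`, `ξ ≠ 0`, is `0`.**
[cite: Weil1965, Chap. IV n° 41, (35) p. 59] -/
theorem orbitFunctional_eq_zero_of_forall (Φ : piSchwartzBruhat F (Fin m))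
    (h0 : ∀ (g : G) (ξ : NonzeroRat F m),
      (Φ : (Fin m → AdeleRing (𝓞 F) F) → ℂ) (A g (ratPt F (Fin m) (ξ : Fin m → F))) = 0) :
    orbitFunctional F Γ ν A hA hΓ Φ = 0 := by
  rw [orbitFunctional_apply]
  have h : (fun q => orbitSumQuot F Γ A hΓ (Φ : (Fin m → AdeleRing (𝓞 F) F) → ℂ) q) = fun _ => 0 :=
    funext fun q => by
      induction q using QuotientGroup.induction_on with
      | H g =>
        rw [orbitSumQuot_mk]
        exact orbitSum_eq_zero_of_forall F A g (h0 g)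
  rw [h, integral_zero]

omit [NumberField F] in
/-- a function supported inside a set on which `h mod F ≠ 0` vanishes at every point where `h ∈ F`.
[cite: Weil1965, Chap. IV n° 41, (35) p. 59] -/
theorem apply_eq_zero_of_tsupport_subset [NumberField F] {Ψ : (Fin m → AdeleRing (𝓞 F) F) → ℝ}
    (h : (Fin m → AdeleRing (𝓞 F) F) → AdeleRing (𝓞 F) F) (L : Set (Fin m → AdeleRing (𝓞 F) F))
    (hL0 : ∀ x ∈ L, (QuotientAddGroup.mk (h x) : adeleQuotient F) ≠ 0)
    (hΨL : tsupport Ψ ⊆ L) {x : Fin m → AdeleRing (𝓞 F) F}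
    (hx : h x ∈ Set.range (algebraMap F (AdeleRing (𝓞 F) F))) : Ψ x = 0 := by
  by_contra hne
  obtain ⟨a, ha⟩ := hx
  refine hL0 x (hΨL (subset_tsupport _ (Function.mem_support.mpr hne))) ?_
  rw [QuotientAddGroup.eq_zero_iff]
  exact ⟨a, ha⟩

include hA in
/-- **AN INVARIANT, RATIONALLY-VALUED `h` CARRIES `Λ_ℝ`**: if `h (A g x) = h x` and `h(ξ) ∈ F` for `ξ ∈ F^m`, then
`Λ_ℝ(Ψ) = 0` for every `Ψ ∈ 𝒮_ℝ(𝔸_F^m)` supported in a set on which `h mod F ≠ 0` — every orbit point `A(g) ξ` has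
`h(A(g) ξ) = h(ξ) ∈ F`. [cite: Weil1965, Chap. IV n° 41, (35) p. 59] -/
theorem orbitFunctionalReal_eq_zero_of_tsupport_subset (h : (Fin m → AdeleRing (𝓞 F) F) → AdeleRing (𝓞 F) F)
    (hinv : ∀ (g : G) (x : Fin m → AdeleRing (𝓞 F) F), h (A g x) = h x)
    (hrat : ∀ ξ : Fin m → F, h (ratPt F (Fin m) ξ) ∈ Set.range (algebraMap F (AdeleRing (𝓞 F) F)))
    (Ψ : piSchwartzBruhatReal F (Fin m)) (L : Set (Fin m → AdeleRing (𝓞 F) F))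
    (hL0 : ∀ x ∈ L, (QuotientAddGroup.mk (h x) : adeleQuotient F) ≠ 0)
    (hΨL : tsupport (Ψ : (Fin m → AdeleRing (𝓞 F) F) → ℝ) ⊆ L) :
    orbitFunctionalReal F Γ ν A hA hΓ Ψ = 0 := by
  rw [orbitFunctionalReal_apply, orbitFunctional_eq_zero_of_forall F Γ ν A hA hΓ (ofRealSB F Ψ) fun g ξ => ?_,
    Complex.zero_re]
  have hx : h (A g (ratPt F (Fin m) (ξ : Fin m → F))) ∈ Set.range (algebraMap F (AdeleRing (𝓞 F) F)) := by
    rw [hinv]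
    exact hrat _
  rw [coe_ofRealSB, apply_eq_zero_of_tsupport_subset F h L hL0 hΨL hx, Complex.ofReal_zero]

include hA in
/-- the same in the exact shape of the hypothesis `hS0` ∕ `h0₁` of ★ `sum_fibreMeasure` ∕ ★ `schwartzBruhatMeasure_apply_eq_zero`
∕ ★ `linearMap_eq_smul_of_fibreMeasure_eq` (the compactness of `L` is not needed). [cite: Weil1965, Chap. IV n° 41, (35) p. 59] -/
theorem orbitFunctionalReal_support (h : (Fin m → AdeleRing (𝓞 F) F) → AdeleRing (𝓞 F) F)
    (hinv : ∀ (g : G) (x : Fin m → AdeleRing (𝓞 F) F), h (A g x) = h x)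
    (hrat : ∀ ξ : Fin m → F, h (ratPt F (Fin m) ξ) ∈ Set.range (algebraMap F (AdeleRing (𝓞 F) F))) :
    ∀ (Ψ : piSchwartzBruhatReal F (Fin m)) (L : Set (Fin m → AdeleRing (𝓞 F) F)), IsCompact L →
      (∀ x ∈ L, (QuotientAddGroup.mk (h x) : adeleQuotient F) ≠ 0) →
      tsupport (Ψ : (Fin m → AdeleRing (𝓞 F) F) → ℝ) ⊆ L → orbitFunctionalReal F Γ ν A hA hΓ Ψ = 0 :=
  fun Ψ L _ hL0 hΨL => orbitFunctionalReal_eq_zero_of_tsupport_subset F Γ ν A hA hΓ h hinv hrat Ψ L hL0 hΨL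

/-! ### §1b Generic: the action preserves `ν_{Λ_ℝ}` and its fibre measures along an invariant `h` -/

include hA in
/-- **THE GEOMETRIC ACTION PRESERVES `ν_{Λ_ℝ}`** (`ν` invariant): `(A g)_* ν_{Λ_ℝ} = ν_{Λ_ℝ}` — ★ `map_schwartzBruhatMeasure_eq`
fed with ★ `orbitFunctionalReal_comp` and the stability `Φ ∘ A(g) = twist L_g Φ ∈ 𝒮` (★ `twist_actTwistGL`, ★ `twist_mem`).
[cite: Weil1965, Chap. IV n° 46, p. 66] -/
theorem map_schwartzBruhatMeasure_orbitFunctionalReal_eq [MeasurableSpace (AdeleRing (𝓞 F) F)]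
    [BorelSpace (AdeleRing (𝓞 F) F)] [SMulInvariantMeasure G (G ⧸ Γ) ν] (g : G) :
    (schwartzBruhatMeasure F (Fin m) (orbitFunctionalReal F Γ ν A hA hΓ) (orbitFunctionalReal_nonneg F Γ ν A hA hΓ)).map
        (A g) =
      schwartzBruhatMeasure F (Fin m) (orbitFunctionalReal F Γ ν A hA hΓ) (orbitFunctionalReal_nonneg F Γ ν A hA hΓ) := by
  let T : (Fin m → AdeleRing (𝓞 F) F) ≃ₜ (Fin m → AdeleRing (𝓞 F) F) :=
    { toEquiv := (A g).toEquiv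
      continuous_toFun := LinearMap.continuous_on_pi (A g).toLinearMap
      continuous_invFun := LinearMap.continuous_on_pi (A g).symm.toLinearMap }
  have hTS : ∀ Φ ∈ piSchwartzBruhat F (Fin m), Φ ∘ ⇑T ∈ piSchwartzBruhat F (Fin m) := fun Φ hΦ => by
    have hc : Φ ∘ ⇑T = twist F (actTwistGL F A g) Φ := funext fun x => (twist_actTwistGL F A g Φ x).symm
    rw [hc]
    exact twist_mem hΦ _
  exact map_schwartzBruhatMeasure_eq F (Fin m) (orbitFunctionalReal F Γ ν A hA hΓ) (orbitFunctionalReal_nonneg F Γ ν A hA hΓ)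
    T hTS fun Ψ hΨT => orbitFunctionalReal_comp F Γ ν A hA hΓ g Ψ ⟨_, hΨT⟩ fun _ => rfl

include hA in
/-- **THE GEOMETRIC ACTION PRESERVES EVERY FIBRE MEASURE `μ̂_b = ν_{Λ_ℝ}|_{h⁻¹(b)}`** of an invariant `h` (`h (A g x) = h x`,
`ν` invariant) — ★ `map_fibreMeasure_eq`. [cite: Weil1965, Chap. IV n° 46, p. 66] -/
theorem map_fibreMeasure_orbitFunctionalReal_eq [MeasurableSpace (AdeleRing (𝓞 F) F)]
    [BorelSpace (AdeleRing (𝓞 F) F)] [SMulInvariantMeasure G (G ⧸ Γ) ν]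
    (h : (Fin m → AdeleRing (𝓞 F) F) → AdeleRing (𝓞 F) F)
    (hinv : ∀ (g : G) (x : Fin m → AdeleRing (𝓞 F) F), h (A g x) = h x) (g : G) (b : F) :
    (fibreMeasure F (Fin m) (orbitFunctionalReal F Γ ν A hA hΓ) (orbitFunctionalReal_nonneg F Γ ν A hA hΓ) h b).map (A g) =
      fibreMeasure F (Fin m) (orbitFunctionalReal F Γ ν A hA hΓ) (orbitFunctionalReal_nonneg F Γ ν A hA hΓ) h b := by
  let T : (Fin m → AdeleRing (𝓞 F) F) ≃ₜ (Fin m → AdeleRing (𝓞 F) F) :=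
    { toEquiv := (A g).toEquiv
      continuous_toFun := LinearMap.continuous_on_pi (A g).toLinearMap
      continuous_invFun := LinearMap.continuous_on_pi (A g).symm.toLinearMap }
  have hTS : ∀ Φ ∈ piSchwartzBruhat F (Fin m), Φ ∘ ⇑T ∈ piSchwartzBruhat F (Fin m) := fun Φ hΦ => by
    have hc : Φ ∘ ⇑T = twist F (actTwistGL F A g) Φ := funext fun x => (twist_actTwistGL F A g Φ x).symm
    rw [hc]
    exact twist_mem hΦ _
  exact map_fibreMeasure_eq F (Fin m) (orbitFunctionalReal F Γ ν A hA hΓ) (orbitFunctionalReal_nonneg F Γ ν A hA hΓ) h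
    T (fun x => hinv g x) hTS (fun Ψ hΨT => orbitFunctionalReal_comp F Γ ν A hA hΓ g Ψ ⟨_, hΨT⟩ fun _ => rfl) b

end Generic

end Literature.NumberTheory.Weil1965

/-! ### §2 The dual pair: `hNorm` is rational on rational points, hence carries `Λ_θ` -/

namespace Literature.NumberTheory.Weil1965.UnitaryDoubling

open scoped Matrix Kronecker
open _root_.MeasureTheory NumberField
open Literature.RepresentationTheory.HeisenbergGroup
open Literature.RepresentationTheory.HeisenbergGroup.SymplecticMatrix
open Literature.NumberTheory.Weil1964 Literature.NumberTheory.Weil1965 Literature.NumberTheory.Automorphic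
open Literature.NumberTheory.Automorphic.UnitaryGroup (reindexW reindexW_apply reindexW_symm_apply
  isQuadraticCoordinates_adele quadraticAdeleEquiv)
open Literature.NumberTheory.Automorphic.UnitaryGroup.QuadraticCoordinates
open Literature.NumberTheory.GelbartRogawski1991 Literature.NumberTheory.GelbartRogawski1991.UnitaryDualPair

section RatPair

variable (F E : Type) [Field F] [NumberField F] [Field E] [NumberField E] [Algebra F E] [Algebra.IsQuadraticExtension F E]
  (c : E ≃ₐ[F] E) {δ : E} (hcδ : c δ = -δ) (hδ : δ ≠ 0) {d : F} (hd : δ * δ = algebraMap F E d)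

/-- `Ψ_𝔸 (a, b) = (a ⊗ 1) + (b ⊗ 1) δ` (definitional). [folklore] -/
private theorem quadEquiv_apply (a b : AdeleRing (𝓞 F) F) :
    (quadraticAdeleEquiv F E c hcδ hδ).toAddEquiv (a, b) =
      AdeleRing.baseChange F E a + AdeleRing.baseChange F E b * algebraMap E (AdeleRing (𝓞 E) E) δ := rfl

/-- rational pairs are stable under addition. [folklore] -/
private theorem ratPair_add {z w : AdeleRing (𝓞 E) E}
    (hz : ∃ a b : F, z = (quadraticAdeleEquiv F E c hcδ hδ).toAddEquiv
      (algebraMap F (AdeleRing (𝓞 F) F) a, algebraMap F (AdeleRing (𝓞 F) F) b))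
    (hw : ∃ a b : F, w = (quadraticAdeleEquiv F E c hcδ hδ).toAddEquiv
      (algebraMap F (AdeleRing (𝓞 F) F) a, algebraMap F (AdeleRing (𝓞 F) F) b)) :
    ∃ a b : F, z + w = (quadraticAdeleEquiv F E c hcδ hδ).toAddEquiv
      (algebraMap F (AdeleRing (𝓞 F) F) a, algebraMap F (AdeleRing (𝓞 F) F) b) := by
  obtain ⟨a, b, rfl⟩ := hz
  obtain ⟨a', b', rfl⟩ := hw
  refine ⟨a + a', b + b', ?_⟩
  rw [map_add (algebraMap F (AdeleRing (𝓞 F) F)), map_add (algebraMap F (AdeleRing (𝓞 F) F)), ← Prod.mk_add_mk, map_add]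

/-- rational pairs are stable under finite sums. [folklore] -/
private theorem ratPair_sum {ι : Type*} (s : Finset ι) (f : ι → AdeleRing (𝓞 E) E)
    (hf : ∀ i ∈ s, ∃ a b : F, f i = (quadraticAdeleEquiv F E c hcδ hδ).toAddEquiv
      (algebraMap F (AdeleRing (𝓞 F) F) a, algebraMap F (AdeleRing (𝓞 F) F) b)) :
    ∃ a b : F, ∑ i ∈ s, f i = (quadraticAdeleEquiv F E c hcδ hδ).toAddEquiv
      (algebraMap F (AdeleRing (𝓞 F) F) a, algebraMap F (AdeleRing (𝓞 F) F) b) := by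
  refine Finset.sum_induction f (fun z => ∃ a b : F, z = (quadraticAdeleEquiv F E c hcδ hδ).toAddEquiv
      (algebraMap F (AdeleRing (𝓞 F) F) a, algebraMap F (AdeleRing (𝓞 F) F) b)) (fun _ _ hz hw => ratPair_add F E c hcδ hδ hz hw)
    ⟨0, 0, ?_⟩ hf
  rw [map_zero, Prod.mk_zero_zero, map_zero]

include hd in
/-- rational pairs are stable under multiplication (`(a + bδ)(a' + b'δ) = (aa' + d bb') + (ab' + ba') δ`). [folklore] -/
private theorem ratPair_mul {z w : AdeleRing (𝓞 E) E}
    (hz : ∃ a b : F, z = (quadraticAdeleEquiv F E c hcδ hδ).toAddEquiv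
      (algebraMap F (AdeleRing (𝓞 F) F) a, algebraMap F (AdeleRing (𝓞 F) F) b))
    (hw : ∃ a b : F, w = (quadraticAdeleEquiv F E c hcδ hδ).toAddEquiv
      (algebraMap F (AdeleRing (𝓞 F) F) a, algebraMap F (AdeleRing (𝓞 F) F) b)) :
    ∃ a b : F, z * w = (quadraticAdeleEquiv F E c hcδ hδ).toAddEquiv
      (algebraMap F (AdeleRing (𝓞 F) F) a, algebraMap F (AdeleRing (𝓞 F) F) b) := by
  obtain ⟨a, b, rfl⟩ := hz
  obtain ⟨a', b', rfl⟩ := hw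
  refine ⟨a * a' + d * (b * b'), a * b' + b * a', ?_⟩
  rw [quadEquiv_apply, quadEquiv_apply, quadEquiv_apply, (isQuadraticCoordinates_adele E c hcδ hδ hd).mul_formula]
  simp only [map_add, map_mul]

omit [NumberField F] [Algebra.IsQuadraticExtension F E] in
include hcδ in
/-- `(c ⊗ 1) (δ ⊗ 1) = -(δ ⊗ 1)` (★ `algebraMap_conj`). [folklore] -/
private theorem conjAdele_algebraMap_delta :
    UnitaryGroup.conjAdele F E c (algebraMap E (AdeleRing (𝓞 E) E) δ) = -algebraMap E (AdeleRing (𝓞 E) E) δ := by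
  rw [← map_neg, ← hcδ]
  exact (UnitaryGroup.algebraMap_conj F E c δ).symm

omit [Algebra.IsQuadraticExtension F E] in
/-- `c ⊗ 1` fixes `F ⊗ 1 ⊆ 𝔸_E` (★ `algebraMap_conj`, `c` is `F`-linear). [folklore] -/
private theorem conjAdele_baseChange_algebraMap (a : F) :
    UnitaryGroup.conjAdele F E c (AdeleRing.baseChange F E (algebraMap F (AdeleRing (𝓞 F) F) a)) =
      AdeleRing.baseChange F E (algebraMap F (AdeleRing (𝓞 F) F) a) := by
  rw [AdeleRing.baseChange_algebraMap, ← UnitaryGroup.algebraMap_conj]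
  show algebraMap E (AdeleRing (𝓞 E) E) (c (algebraMap F E a)) = _
  rw [AlgEquiv.commutes]

/-- rational pairs are stable under the conjugation `c ⊗ 1` (`conj (a + bδ) = a − bδ`). [folklore] -/
private theorem ratPair_conj {z : AdeleRing (𝓞 E) E}
    (hz : ∃ a b : F, z = (quadraticAdeleEquiv F E c hcδ hδ).toAddEquiv
      (algebraMap F (AdeleRing (𝓞 F) F) a, algebraMap F (AdeleRing (𝓞 F) F) b)) :
    ∃ a b : F, UnitaryGroup.conjAdele F E c z = (quadraticAdeleEquiv F E c hcδ hδ).toAddEquiv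
      (algebraMap F (AdeleRing (𝓞 F) F) a, algebraMap F (AdeleRing (𝓞 F) F) b) := by
  obtain ⟨a, b, rfl⟩ := hz
  refine ⟨a, -b, ?_⟩
  rw [quadEquiv_apply, quadEquiv_apply, map_add, map_mul, conjAdele_baseChange_algebraMap F E c,
    conjAdele_baseChange_algebraMap F E c, conjAdele_algebraMap_delta F E c hcδ, map_neg, map_neg, mul_neg, neg_mul]

/-- `F ⊆ E ⊆ 𝔸_E` consists of rational pairs (`t = t + 0·δ`). [folklore] -/
private theorem ratPair_algebraMap (t : F) :
    ∃ a b : F, algebraMap E (AdeleRing (𝓞 E) E) (algebraMap F E t) = (quadraticAdeleEquiv F E c hcδ hδ).toAddEquiv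
      (algebraMap F (AdeleRing (𝓞 F) F) a, algebraMap F (AdeleRing (𝓞 F) F) b) :=
  ⟨t, 0, by rw [quadEquiv_apply, map_zero, map_zero, zero_mul, add_zero, AdeleRing.baseChange_algebraMap]⟩

include hd in
/-- the hermitian form of a matrix with rational-pair entries on rational-pair vectors is a rational pair. [folklore] -/
private theorem ratPair_hermForm {ι : Type*} [Fintype ι] (H : Matrix ι ι (AdeleRing (𝓞 E) E)) (z : ι → AdeleRing (𝓞 E) E)
    (hH : ∀ i j, ∃ a b : F, H i j = (quadraticAdeleEquiv F E c hcδ hδ).toAddEquiv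
      (algebraMap F (AdeleRing (𝓞 F) F) a, algebraMap F (AdeleRing (𝓞 F) F) b))
    (hz : ∀ i, ∃ a b : F, z i = (quadraticAdeleEquiv F E c hcδ hδ).toAddEquiv
      (algebraMap F (AdeleRing (𝓞 F) F) a, algebraMap F (AdeleRing (𝓞 F) F) b)) :
    ∃ a b : F, UnitaryGroup.hermForm (UnitaryGroup.conjAdele F E c) H z z = (quadraticAdeleEquiv F E c hcδ hδ).toAddEquiv
      (algebraMap F (AdeleRing (𝓞 F) F) a, algebraMap F (AdeleRing (𝓞 F) F) b) := by
  rw [UnitaryGroup.hermForm_apply, dotProduct]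
  refine ratPair_sum F E c hcδ hδ _ _ fun i _ => ratPair_mul F E c hcδ hδ hd (ratPair_conj F E c hcδ hδ (hz i)) ?_
  rw [Matrix.mulVec, dotProduct]
  exact ratPair_sum F E c hcδ hδ _ _ fun j _ => ratPair_mul F E c hcδ hδ hd (hH i j) (hz j)

/-- matrix inversion commutes with entrywise ring maps on unit-determinant matrices. [folklore] -/
private theorem map_nonsing_inv' {k R S : Type*} [Fintype k] [DecidableEq k] [CommRing R] [CommRing S] (f : R →+* S)
    {M : Matrix k k R} (hM : IsUnit M.det) : (M⁻¹).map f = (M.map f)⁻¹ := by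
  symm
  apply Matrix.inv_eq_left_inv
  rw [← Matrix.map_mul, Matrix.nonsing_inv_mul _ hM, Matrix.map_one _ (map_zero f) (map_one f)]

end RatPair

section DualPair

variable (F E : Type) [Field F] [NumberField F] [Field E] [NumberField E] [Algebra F E] [Algebra.IsQuadraticExtension F E]
  (c : E ≃ₐ[F] E) {δ : E} (hcδ : c δ = -δ) (hδ : δ ≠ 0) {d : F} (hd : δ * δ = algebraMap F E d)
  (N : ℕ) {n : ℕ} (e : Fin N × Fin 1 ≃ Fin n)
  (TV : Matrix (Fin N) (Fin N) F) (hV : TV.IsSymm) (hVd : IsUnit TV.det)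
  (TW : Matrix (Fin 1) (Fin 1) F) (hW : TW.IsSymm) (hWd : IsUnit TW.det)

/-- `Ψ_𝔸 (x, y) = x + y δ ∈ E ⊆ 𝔸_E` for `x, y ∈ F` (★ `quadraticAdeleMap_algebraMap`). [folklore] -/
private theorem quadEquiv_algebraMap (x y : F) :
    (quadraticAdeleEquiv F E c hcδ hδ).toAddEquiv (algebraMap F (AdeleRing (𝓞 F) F) x, algebraMap F (AdeleRing (𝓞 F) F) y) =
      algebraMap E (AdeleRing (𝓞 E) E) (algebraMap F E x + algebraMap F E y * δ) :=
  UnitaryGroup.quadraticAdeleMap_algebraMap E δ x y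

/-- **the `𝔸_E`-coordinates of a RATIONAL point, in the coordinates `𝔸_E = 𝔸_F ⊕ 𝔸_F δ`**:
`toHermVec ξ i = Ψ_𝔸(ξ|₁ (e i), (𝕋_F⁻¹ ξ|₂) (e i))` — the Darboux map `θ_𝕋⁻¹ = (·|₁, 𝕋⁻¹ ·|₂)` and the Gram matrix
`𝕋 = 𝕋_F ⊗ 1` are defined over `F`. [cite: GelbartRogawski1991, §3.1 p. 454] -/
theorem toHermVec_ratPt_eq (ξ : Fin (n + n) → F) (i : Fin N × Fin 1) :
    toHermVec F E c hcδ hδ N e TV hVd TW hWd (ratPt F (Fin (n + n)) ξ) i =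
      (quadraticAdeleEquiv F E c hcδ hδ).toAddEquiv
        (algebraMap F (AdeleRing (𝓞 F) F) (ξ (finSumFinEquiv (Sum.inl (e i)))),
          algebraMap F (AdeleRing (𝓞 F) F) (((gram F e TV TW)⁻¹ *ᵥ fun j => ξ (finSumFinEquiv (Sum.inr j))) (e i))) := by
  rw [toHermVec, reIm_symm_apply, reindexW_symm_apply, darboux_symm_apply]
  refine congrArg _ (Prod.ext rfl ?_)
  show ((adelicGram F e TV TW)⁻¹ *ᵥ (⇑(algebraMap F (AdeleRing (𝓞 F) F)) ∘ fun j => ξ (finSumFinEquiv (Sum.inr j)))) (e i) = _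
  rw [RingHom.map_mulVec, map_nonsing_inv' _ (isUnit_det_gram F e hVd hWd), ← adelicGram_eq_map]

/-- **THE RATIONAL VALUE of `toHermVec` on a rational point**: `toHermVec ξ i = z_ξ i ∈ E ⊆ 𝔸_E` with the explicit
`z_ξ i = ξ|₁(e i) + (𝕋_F⁻¹ ξ|₂)(e i) · δ`. [cite: GelbartRogawski1991, §3.1 p. 454] -/
theorem toHermVec_ratPt_apply (ξ : Fin (n + n) → F) (i : Fin N × Fin 1) :
    toHermVec F E c hcδ hδ N e TV hVd TW hWd (ratPt F (Fin (n + n)) ξ) i =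
      algebraMap E (AdeleRing (𝓞 E) E) (algebraMap F E (ξ (finSumFinEquiv (Sum.inl (e i)))) +
        algebraMap F E (((gram F e TV TW)⁻¹ *ᵥ fun j => ξ (finSumFinEquiv (Sum.inr j))) (e i)) * δ) :=
  (toHermVec_ratPt_eq F E c hcδ hδ N e TV hVd TW hWd ξ i).trans (quadEquiv_algebraMap F E c hcδ hδ _ _)

/-- **`toHermVec ξ = 0 ↔ ξ = 0` on rational points** (injectivity of `E ⊆ 𝔸_E`, of `(x, y) ↦ x + yδ` on `F²` through `Ψ_𝔸`,
and of `𝕋_F⁻¹`). [cite: GelbartRogawski1991, §3.1 p. 454] -/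
theorem toHermVec_ratPt_eq_zero_iff (ξ : Fin (n + n) → F) :
    toHermVec F E c hcδ hδ N e TV hVd TW hWd (ratPt F (Fin (n + n)) ξ) = 0 ↔ ξ = 0 := by
  refine ⟨fun h0 => ?_, fun h0 => ?_⟩
  · have hφ := AdeleRing.algebraMap_injective (𝓞 F) F
    have hi : ∀ i, ξ (finSumFinEquiv (Sum.inl (e i))) = 0 ∧
        ((gram F e TV TW)⁻¹ *ᵥ fun j => ξ (finSumFinEquiv (Sum.inr j))) (e i) = 0 := fun i => by
      have h := congrFun h0 i
      rw [toHermVec_ratPt_eq, Pi.zero_apply, AddEquiv.map_eq_zero_iff, Prod.mk_eq_zero] at h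
      exact ⟨hφ (h.1.trans (map_zero _).symm), hφ (h.2.trans (map_zero _).symm)⟩
    have h2 : (fun j => ξ (finSumFinEquiv (Sum.inr j))) = 0 := by
      have h3 : (gram F e TV TW)⁻¹ *ᵥ (fun j => ξ (finSumFinEquiv (Sum.inr j))) = 0 :=
        funext fun k => by simpa only [Equiv.apply_symm_apply, Pi.zero_apply] using (hi (e.symm k)).2
      have h4 := congrArg (fun v => gram F e TV TW *ᵥ v) h3
      simpa only [Matrix.mulVec_mulVec, Matrix.mul_nonsing_inv _ (isUnit_det_gram F e hVd hWd), Matrix.one_mulVec,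
        Matrix.mulVec_zero] using h4
    funext k
    obtain ⟨i, hk⟩ | ⟨j, hk⟩ : (∃ i, k = finSumFinEquiv (Sum.inl i)) ∨ ∃ j, k = finSumFinEquiv (Sum.inr j) := by
      rcases hs : finSumFinEquiv.symm k with i | j
      · exact Or.inl ⟨i, by rw [← hs, Equiv.apply_symm_apply]⟩
      · exact Or.inr ⟨j, by rw [← hs, Equiv.apply_symm_apply]⟩
    · rw [hk, Pi.zero_apply]
      simpa only [Equiv.apply_symm_apply] using (hi (e.symm i)).1
    · rw [hk, Pi.zero_apply]
      exact congrFun h2 j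
  · rw [h0, ratPt_zero]
    funext i
    rw [toHermVec, Pi.zero_comp, map_zero, map_zero, map_zero, Pi.zero_apply]

omit [NumberField F] [Algebra.IsQuadraticExtension F E] in
/-- `adelicForm (J_V) ⊗ₖ adelicForm (J_W) = (J_V ⊗ₖ J_W) ⊗ 1` entrywise. [folklore] -/
private theorem adelicForm_kronecker_apply (i j : Fin N × Fin 1) :
    (UnitaryGroup.adelicForm E N (TV.map (algebraMap F E)) ⊗ₖ UnitaryGroup.adelicForm E 1 (TW.map (algebraMap F E))) i j =
      algebraMap E (AdeleRing (𝓞 E) E) (((TV.map (algebraMap F E)) ⊗ₖ (TW.map (algebraMap F E))) i j) := by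
  rw [Matrix.kroneckerMap_apply, Matrix.kroneckerMap_apply, map_mul]
  rfl

omit [NumberField F] [Algebra.IsQuadraticExtension F E] in
/-- `E ⊆ 𝔸_E` transports the hermitian form: `h_𝔸(z ⊗ 1, w ⊗ 1) = h(z, w) ⊗ 1` (★ `algebraMap_conj`). [folklore] -/
private theorem algebraMap_hermForm {ι : Type*} [Fintype ι] (H : Matrix ι ι E) (H' : Matrix ι ι (AdeleRing (𝓞 E) E))
    (hH : ∀ i j, H' i j = algebraMap E (AdeleRing (𝓞 E) E) (H i j)) (z w : ι → E) :
    UnitaryGroup.hermForm (UnitaryGroup.conjAdele F E c) H' (fun i => algebraMap E (AdeleRing (𝓞 E) E) (z i))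
        (fun i => algebraMap E (AdeleRing (𝓞 E) E) (w i)) =
      algebraMap E (AdeleRing (𝓞 E) E) (UnitaryGroup.hermForm (c : E →+* E) H z w) := by
  simp only [UnitaryGroup.hermForm_apply, dotProduct, Matrix.mulVec, Function.comp_apply, hH, map_sum, map_mul,
    UnitaryGroup.algebraMap_conj]

/-- **THE RATIONAL VALUE OF THE HERMITIAN FORM on a rational point**: `h_𝔸(toHermVec ξ, toHermVec ξ) = h(z_ξ, z_ξ) ⊗ 1`
with `h = J_V ⊗ J_W` over `E` and the explicit `z_ξ ∈ E^{N×1}` of `toHermVec_ratPt_apply`. [cite: Weil1965, Chap. IV n° 41, (35) p. 59] -/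
theorem hermForm_toHermVec_ratPt (ξ : Fin (n + n) → F) :
    UnitaryGroup.hermForm (UnitaryGroup.conjAdele F E c)
        (UnitaryGroup.adelicForm E N (TV.map (algebraMap F E)) ⊗ₖ UnitaryGroup.adelicForm E 1 (TW.map (algebraMap F E)))
        (toHermVec F E c hcδ hδ N e TV hVd TW hWd (ratPt F (Fin (n + n)) ξ))
        (toHermVec F E c hcδ hδ N e TV hVd TW hWd (ratPt F (Fin (n + n)) ξ)) =
      algebraMap E (AdeleRing (𝓞 E) E) (UnitaryGroup.hermForm (c : E →+* E)
        ((TV.map (algebraMap F E)) ⊗ₖ (TW.map (algebraMap F E)))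
        (fun i => algebraMap F E (ξ (finSumFinEquiv (Sum.inl (e i)))) +
          algebraMap F E (((gram F e TV TW)⁻¹ *ᵥ fun j => ξ (finSumFinEquiv (Sum.inr j))) (e i)) * δ)
        (fun i => algebraMap F E (ξ (finSumFinEquiv (Sum.inl (e i)))) +
          algebraMap F E (((gram F e TV TW)⁻¹ *ᵥ fun j => ξ (finSumFinEquiv (Sum.inr j))) (e i)) * δ)) := by
  have hz : toHermVec F E c hcδ hδ N e TV hVd TW hWd (ratPt F (Fin (n + n)) ξ) =
      fun i => algebraMap E (AdeleRing (𝓞 E) E) (algebraMap F E (ξ (finSumFinEquiv (Sum.inl (e i)))) +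
        algebraMap F E (((gram F e TV TW)⁻¹ *ᵥ fun j => ξ (finSumFinEquiv (Sum.inr j))) (e i)) * δ) :=
    funext (toHermVec_ratPt_apply F E c hcδ hδ N e TV hVd TW hWd ξ)
  rw [hz]
  exact algebraMap_hermForm F E c _ _ (adelicForm_kronecker_apply F E N TV TW) _ _

/-- **THE HERMITIAN NORM OF A RATIONAL POINT, EXPLICITLY**: `hNorm ξ = re Ψ_𝔸 (h(z_ξ, z_ξ) ⊗ 1)`.
[cite: Weil1965, Chap. IV n° 41, (35) p. 59] -/
theorem hNorm_ratPt_eq (ξ : Fin (n + n) → F) :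
    hNorm F E c hcδ hδ N e TV hVd TW hWd (ratPt F (Fin (n + n)) ξ) =
      re (quadraticAdeleEquiv F E c hcδ hδ).toAddEquiv (algebraMap E (AdeleRing (𝓞 E) E) (UnitaryGroup.hermForm (c : E →+* E)
        ((TV.map (algebraMap F E)) ⊗ₖ (TW.map (algebraMap F E)))
        (fun i => algebraMap F E (ξ (finSumFinEquiv (Sum.inl (e i)))) +
          algebraMap F E (((gram F e TV TW)⁻¹ *ᵥ fun j => ξ (finSumFinEquiv (Sum.inr j))) (e i)) * δ)
        (fun i => algebraMap F E (ξ (finSumFinEquiv (Sum.inl (e i)))) +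
          algebraMap F E (((gram F e TV TW)⁻¹ *ᵥ fun j => ξ (finSumFinEquiv (Sum.inr j))) (e i)) * δ))) := by
  rw [hNorm, hermForm_toHermVec_ratPt]

include hd in
/-- **`hNorm ξ = t ⊗ 1` when `h(z_ξ, z_ξ) = t ∈ F`** (`re Ψ_𝔸 (t ⊗ 1) = t`, ★ `IsQuadraticCoordinates.re_map`) — the form in which
an anisotropy statement `hNorm ξ = 0 ↔ ξ = 0` is read off. [cite: Weil1965, Chap. IV n° 41, (35) p. 59] -/
theorem hNorm_ratPt_eq_algebraMap (ξ : Fin (n + n) → F) (t : F)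
    (ht : UnitaryGroup.hermForm (c : E →+* E) ((TV.map (algebraMap F E)) ⊗ₖ (TW.map (algebraMap F E)))
        (fun i => algebraMap F E (ξ (finSumFinEquiv (Sum.inl (e i)))) +
          algebraMap F E (((gram F e TV TW)⁻¹ *ᵥ fun j => ξ (finSumFinEquiv (Sum.inr j))) (e i)) * δ)
        (fun i => algebraMap F E (ξ (finSumFinEquiv (Sum.inl (e i)))) +
          algebraMap F E (((gram F e TV TW)⁻¹ *ᵥ fun j => ξ (finSumFinEquiv (Sum.inr j))) (e i)) * δ) = algebraMap F E t) :
    hNorm F E c hcδ hδ N e TV hVd TW hWd (ratPt F (Fin (n + n)) ξ) = algebraMap F (AdeleRing (𝓞 F) F) t := by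
  rw [hNorm_ratPt_eq, ht, ← AdeleRing.baseChange_algebraMap]
  exact (isQuadraticCoordinates_adele E c hcδ hδ hd).re_map _

include hd in
/-- **RATIONALITY OF THE HERMITIAN NORM ON RATIONAL POINTS**: `hNorm(ξ) ∈ F ⊆ 𝔸_F` for `ξ ∈ F^{n+n}` — the invariant `i_X`
is a polynomial map defined over `F` (hermitian form `J_V ⊗ J_W` with entries in `F ⊆ E`, coordinates `𝔸_E = 𝔸_F ⊕ 𝔸_F δ`;
proved by closure of the `F`-rational pairs `Ψ_𝔸(F × F)` under `+`, `·`, `c ⊗ 1`). [cite: Weil1965, Chap. IV n° 41, (35) p. 59] -/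
theorem hNorm_ratPt_mem_range (ξ : Fin (n + n) → F) :
    hNorm F E c hcδ hδ N e TV hVd TW hWd (ratPt F (Fin (n + n)) ξ) ∈ Set.range (algebraMap F (AdeleRing (𝓞 F) F)) := by
  obtain ⟨a, b, hab⟩ := ratPair_hermForm F E c hcδ hδ hd
    (UnitaryGroup.adelicForm E N (TV.map (algebraMap F E)) ⊗ₖ UnitaryGroup.adelicForm E 1 (TW.map (algebraMap F E)))
    (toHermVec F E c hcδ hδ N e TV hVd TW hWd (ratPt F (Fin (n + n)) ξ)) (fun i j => by
      rw [Matrix.kroneckerMap_apply]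
      exact ratPair_mul F E c hcδ hδ hd (ratPair_algebraMap F E c hcδ hδ (TV i.1 j.1)) (ratPair_algebraMap F E c hcδ hδ (TW i.2 j.2)))
    (fun i => ⟨_, _, toHermVec_ratPt_eq F E c hcδ hδ N e TV hVd TW hWd ξ i⟩)
  rw [hNorm, hab, re_apply]
  exact ⟨a, rfl⟩

variable [LocallyCompactSpace (UnitaryGroup.adelic F E c N (TV.map (algebraMap F E)))]
  [CompactSpace (UnitaryGroup.adelic F E c N (TV.map (algebraMap F E)) ⧸ (UnitaryGroup.toAdelic F E c N (TV.map (algebraMap F E))).range)]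
  [MeasurableSpace (UnitaryGroup.adelic F E c N (TV.map (algebraMap F E)) ⧸ (UnitaryGroup.toAdelic F E c N (TV.map (algebraMap F E))).range)]
  [BorelSpace (UnitaryGroup.adelic F E c N (TV.map (algebraMap F E)) ⧸ (UnitaryGroup.toAdelic F E c N (TV.map (algebraMap F E))).range)]
  (ν : Measure (UnitaryGroup.adelic F E c N (TV.map (algebraMap F E)) ⧸ (UnitaryGroup.toAdelic F E c N (TV.map (algebraMap F E))).range)) [IsFiniteMeasure ν]

/-- **`Λ_θ` IS CARRIED BY THE RATIONAL FIBRES OF `hNorm`**: `Λ_θ,ℝ(Ψ) = 0` for every `Ψ ∈ 𝒮_ℝ(X□(𝔸))` supported in a set on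
which `hNorm mod F ≠ 0` (★ `hNorm_vDiagAct` + `hNorm_ratPt_mem_range` in §1). [cite: Weil1965, Chap. IV n° 41, (35) p. 59; n° 52] -/
theorem thetaOrbitFunctionalReal_eq_zero_of_tsupport_subset (Ψ : piSchwartzBruhatReal F (Fin (n + n)))
    (L : Set (Fin (n + n) → AdeleRing (𝓞 F) F))
    (hL0 : ∀ x ∈ L, (QuotientAddGroup.mk (hNorm F E c hcδ hδ N e TV hVd TW hWd x) : adeleQuotient F) ≠ 0)
    (hΨL : tsupport (Ψ : (Fin (n + n) → AdeleRing (𝓞 F) F) → ℝ) ⊆ L) :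
    thetaOrbitFunctionalReal F E c hcδ hδ hd N e TV hV hVd TW hW hWd ν Ψ = 0 :=
  orbitFunctionalReal_eq_zero_of_tsupport_subset F (UnitaryGroup.toAdelic F E c N (TV.map (algebraMap F E))).range ν
    (vDiagAct F E c hcδ hδ hd N e TV hV hVd TW hW hWd) (continuous_vDiagAct_apply F E c hcδ hδ hd N e TV hV hVd TW hW hWd)
    (vDiagAct_ratPt_of_mem F E c hcδ hδ hd N e TV hV hVd TW hW hWd) (hNorm F E c hcδ hδ N e TV hVd TW hWd)
    (hNorm_vDiagAct F E c hcδ hδ hd N e TV hV hVd TW hW hWd) (hNorm_ratPt_mem_range F E c hcδ hδ hd N e TV hVd TW hWd) Ψ L hL0 hΨL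

/-- the same in the exact shape of `hS0` ∕ `h0₁` of ★ `sum_fibreMeasure` ∕ ★ `schwartzBruhatMeasure_apply_eq_zero` ∕
★ `linearMap_eq_smul_of_fibreMeasure_eq` with `S := thetaOrbitFunctionalReal … ν`, `h := hNorm …`.
[cite: Weil1965, Chap. IV n° 41, (35) p. 59; n° 52] -/
theorem thetaOrbitFunctionalReal_support :
    ∀ (Ψ : piSchwartzBruhatReal F (Fin (n + n))) (L : Set (Fin (n + n) → AdeleRing (𝓞 F) F)), IsCompact L →
      (∀ x ∈ L, (QuotientAddGroup.mk (hNorm F E c hcδ hδ N e TV hVd TW hWd x) : adeleQuotient F) ≠ 0) →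
      tsupport (Ψ : (Fin (n + n) → AdeleRing (𝓞 F) F) → ℝ) ⊆ L →
        thetaOrbitFunctionalReal F E c hcδ hδ hd N e TV hV hVd TW hW hWd ν Ψ = 0 :=
  fun Ψ L _ hL0 hΨL => thetaOrbitFunctionalReal_eq_zero_of_tsupport_subset F E c hcδ hδ hd N e TV hV hVd TW hW hWd ν Ψ L hL0 hΨL

/-- **`U(J_V)(𝔸)` PRESERVES `ν_{Λ_θ}`** (`ν` invariant). [cite: Weil1965, Chap. IV n° 46, p. 66; n° 52] -/
theorem map_schwartzBruhatMeasure_thetaOrbitFunctionalReal_eq [MeasurableSpace (AdeleRing (𝓞 F) F)]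
    [BorelSpace (AdeleRing (𝓞 F) F)]
    [SMulInvariantMeasure (UnitaryGroup.adelic F E c N (TV.map (algebraMap F E)))
      (UnitaryGroup.adelic F E c N (TV.map (algebraMap F E)) ⧸ (UnitaryGroup.toAdelic F E c N (TV.map (algebraMap F E))).range) ν]
    (g : UnitaryGroup.adelic F E c N (TV.map (algebraMap F E))) :
    (schwartzBruhatMeasure F (Fin (n + n)) (thetaOrbitFunctionalReal F E c hcδ hδ hd N e TV hV hVd TW hW hWd ν)
        (thetaOrbitFunctionalReal_nonneg F E c hcδ hδ hd N e TV hV hVd TW hW hWd ν)).map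
        (vDiagAct F E c hcδ hδ hd N e TV hV hVd TW hW hWd g) =
      schwartzBruhatMeasure F (Fin (n + n)) (thetaOrbitFunctionalReal F E c hcδ hδ hd N e TV hV hVd TW hW hWd ν)
        (thetaOrbitFunctionalReal_nonneg F E c hcδ hδ hd N e TV hV hVd TW hW hWd ν) :=
  map_schwartzBruhatMeasure_orbitFunctionalReal_eq F (UnitaryGroup.toAdelic F E c N (TV.map (algebraMap F E))).range ν
    (vDiagAct F E c hcδ hδ hd N e TV hV hVd TW hW hWd) (continuous_vDiagAct_apply F E c hcδ hδ hd N e TV hV hVd TW hW hWd)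
    (vDiagAct_ratPt_of_mem F E c hcδ hδ hd N e TV hV hVd TW hW hWd) g

/-- **`U(J_V)(𝔸)` PRESERVES EVERY THETA-SIDE FIBRE MEASURE `μ̂_b := ν_{Λ_θ}|_{hNorm⁻¹(b)}`** (★ `hNorm_vDiagAct`, `ν` invariant).
[cite: Weil1965, Chap. IV n° 46, p. 66; n° 52] -/
theorem map_fibreMeasure_thetaOrbitFunctionalReal_eq [MeasurableSpace (AdeleRing (𝓞 F) F)] [BorelSpace (AdeleRing (𝓞 F) F)]
    [SMulInvariantMeasure (UnitaryGroup.adelic F E c N (TV.map (algebraMap F E)))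
      (UnitaryGroup.adelic F E c N (TV.map (algebraMap F E)) ⧸ (UnitaryGroup.toAdelic F E c N (TV.map (algebraMap F E))).range) ν]
    (g : UnitaryGroup.adelic F E c N (TV.map (algebraMap F E))) (b : F) :
    (fibreMeasure F (Fin (n + n)) (thetaOrbitFunctionalReal F E c hcδ hδ hd N e TV hV hVd TW hW hWd ν)
        (thetaOrbitFunctionalReal_nonneg F E c hcδ hδ hd N e TV hV hVd TW hW hWd ν)
        (hNorm F E c hcδ hδ N e TV hVd TW hWd) b).map (vDiagAct F E c hcδ hδ hd N e TV hV hVd TW hW hWd g) =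
      fibreMeasure F (Fin (n + n)) (thetaOrbitFunctionalReal F E c hcδ hδ hd N e TV hV hVd TW hW hWd ν)
        (thetaOrbitFunctionalReal_nonneg F E c hcδ hδ hd N e TV hV hVd TW hW hWd ν)
        (hNorm F E c hcδ hδ N e TV hVd TW hWd) b :=
  map_fibreMeasure_orbitFunctionalReal_eq F (UnitaryGroup.toAdelic F E c N (TV.map (algebraMap F E))).range ν
    (vDiagAct F E c hcδ hδ hd N e TV hV hVd TW hW hWd) (continuous_vDiagAct_apply F E c hcδ hδ hd N e TV hV hVd TW hW hWd)
    (vDiagAct_ratPt_of_mem F E c hcδ hδ hd N e TV hV hVd TW hW hWd) (hNorm F E c hcδ hδ N e TV hVd TW hWd)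
    (hNorm_vDiagAct F E c hcδ hδ hd N e TV hV hVd TW hW hWd) g b

end DualPair

end Literature.NumberTheory.Weil1965.UnitaryDoubling
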